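import Literature.IUT.HodgeTheaters.PiAvatarBinding
import Literature.IUT.HodgeTheaters.InitialThetaDataLocalConjugacy
import HarnessLib

/-!
# [IUTchI] Def 3.1 (e) / Ex 3.3 (i) / Ex 6.3 (i): the bound local object `𝒟_v̲` and `φ^{Θell}_{•,v̲}` of the Π-avatar
# do not depend on the embedding `F̄ ↪ K̄_v̲`, up to a canonical isomorphism OVER `𝒟^{⊚±}`

S. Mochizuki, *Inter-universal Teichmüller theory I*, kurims manuscript (May 2020), Def. 3.1 (e) p. 63 ("the
decomposition group `G_v̲ ⊆ G_K` determined, up to `G_K`-conjugacy, by `v̲`"), Example 3.3 (i) p. 77 (`𝒟_v := 𝓑(X̲→_v̲)⁰`),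
Example 6.3 (i) p. 161 (`φ^{Θell}_{•,v} : 𝒟_v → 𝒟^{⊚±}`) [claim: Mochizuki2012, status: disputed].

PROOF-ONLY (theorems only; no definitions, no instances) over abc-iut-L5-t4's Π-avatar binding (`PiAvatarBinding`:
`D.locModelObj Gv = 𝓑(Π_{X̲→_K} ∩ augGF⁻¹ Gv)⁰`, `D.phiEllAt Gv`) and this seat's `InitialThetaDataLocalConjugacy`
(`exists_localToGF_eq_conj`: two `K`-embeddings `ι, ι' : F̄ → Ω` give `G_K`-conjugate decomposition groups). For the REAL
Def. 3.1 datum `D` and the decomposition groups `G_v̲ = decompositionSubgroupGF F k ι`, `G_v̲' = … ι'` of two embeddings: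
* `exists_decompositionSubgroupGF_conj` — `g ∈ G_v̲' ↔ τ g τ⁻¹ ∈ G_v̲` for some `τ ∈ G_K`;
* `mem_locSub_iff_of_conj` — with `t ∈ Π_{X̲→_K}` over `τ` (`Π_{X̲→_K} ↠ G_K`): `x ∈ Π_{X̲→_K} ∩ augGF⁻¹ G_v̲'` iff
  `t x t⁻¹ ∈ Π_{X̲→_K} ∩ augGF⁻¹ G_v̲`;
* **`exists_iso_locModelObj_of_embeddings`** — an isomorphism `𝒟_v̲(ι) ≅ 𝒟_v̲(ι')` in the ambient orbit category
  (abc-iut-L5-t4's `OrbitCat.isoOfConj t`) COMMUTING with `φ^{Θell}_{•,v̲}` (`t ∈ Π_{X̲→_K} ≤ Π_{X̲_K}` acts trivially on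
  `𝒟^{⊚±} = 𝓑(Π_{X̲_K})⁰`); `isLocIsomorph_locModelObj_of_embeddings` — each is an isomorph of the other (kit predicate
  `IsLocal v`).
So the kit slots `model v`, `phiEll v` of the P5-binding at a good `v̲` are well defined up to a canonical isomorphism
over `𝒟^{⊚±}` — print's "outer"/"up to `G_K`-conjugacy" made explicit. Nothing of the series is asserted; no side taken.
-/

noncomputable section

namespace Literature.IUT.HodgeTheaters

open CategoryTheory

universe u v w w'

/-! ### The decomposition groups of two embeddings are `G_K`-conjugate -/

section GK

variable (F : Type u) {K : Type v} {Fbar : Type w} [Field F] [Field K] [Algebra F K] [Field Fbar]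
  [Algebra F Fbar] [Algebra K Fbar] [IsScalarTower F K Fbar] [Normal K Fbar]
  {Ω : Type w'} [Field Ω] [Algebra K Ω]
  (k : Type w') [Field k] [Algebra K k] [Algebra k Ω] [IsScalarTower K k Ω] (ι ι' : Fbar →ₐ[K] Ω)

/-- **Def. 3.1 (e)**: `G_v̲' = τ⁻¹ G_v̲ τ` for some `τ ∈ G_K` — the decomposition groups in `G_F` of two `K`-embeddings
`F̄ ↪ Ω = K̄_v̲` are `G_K`-conjugate (`g ∈ G_v̲' ↔ τ g τ⁻¹ ∈ G_v̲`). [claim: Mochizuki2012, status: disputed] -/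
theorem exists_decompositionSubgroupGF_conj : ∃ τ ∈ galoisSubgroupOf F K Fbar,
    ∀ g, g ∈ decompositionSubgroupGF F k ι' ↔ τ * g * τ⁻¹ ∈ decompositionSubgroupGF F k ι := by
  obtain ⟨τ, hτK, hτ⟩ := exists_localToGF_eq_conj F k ι ι'
  refine ⟨τ, hτK, fun g => ⟨?_, ?_⟩⟩
  · rintro ⟨σ, rfl⟩
    refine ⟨σ, ?_⟩
    rw [hτ]
    group
  · rintro ⟨σ, hσ⟩
    refine ⟨σ, ?_⟩
    rw [hτ, hσ]
    group

end GK

namespace InitialThetaData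

section Local

variable {F : Type u} {K : Type v} {Fbar : Type w} [Field F] [NumberField F] [Field K] [NumberField K]
  [Algebra F K] [Field Fbar] [Algebra F Fbar] [Algebra K Fbar]
  {E : WeierstrassCurve F} [E.IsElliptic] {l : ℕ} {Pb : BadPlacePredicates K}
  (D : InitialThetaData F K Fbar E l Pb)

/-- Conjugating the decomposition group by `τ = augGF t`, `t ∈ Π_{X̲→_K}`, conjugates `Π_{X̲→_K} ∩ augGF⁻¹ G_v̲` by `t`.
[claim: Mochizuki2012, status: disputed] -/
theorem mem_locSub_iff_of_conj {Gv Gv' : Subgroup (Fbar ≃ₐ[F] Fbar)} {τ : Fbar ≃ₐ[F] Fbar}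
    (hG : ∀ g, g ∈ Gv' ↔ τ * g * τ⁻¹ ∈ Gv) {t : D.PiC} (ht : t ∈ D.PiXarrow) (htτ : D.augGF t = τ)
    (x : D.PiC) : x ∈ D.PiXarrow ⊓ Gv'.comap D.augGF ↔ t * x * t⁻¹ ∈ D.PiXarrow ⊓ Gv.comap D.augGF := by
  rw [Subgroup.mem_inf, Subgroup.mem_inf, Subgroup.mem_comap, Subgroup.mem_comap, map_mul, map_mul, map_inv,
    htτ, ← hG]
  constructor
  · rintro ⟨hx, hg⟩
    exact ⟨D.PiXarrow.mul_mem (D.PiXarrow.mul_mem ht hx) (D.PiXarrow.inv_mem ht), hg⟩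
  · rintro ⟨hx, hg⟩
    refine ⟨?_, hg⟩
    have hmem := D.PiXarrow.mul_mem (D.PiXarrow.mul_mem (D.PiXarrow.inv_mem ht) hx) ht
    have heq : t⁻¹ * (t * x * t⁻¹) * t = x := by group
    rwa [heq] at hmem

end Local

section Embeddings

variable {F : Type u} {K : Type v} {Fbar : Type w} [Field F] [NumberField F] [Field K] [NumberField K]
  [Algebra F K] [Field Fbar] [Algebra F Fbar] [Algebra K Fbar] [IsScalarTower F K Fbar] [Normal K Fbar]
  {E : WeierstrassCurve F} [E.IsElliptic] {l : ℕ} {Pb : BadPlacePredicates K}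
  (D : InitialThetaData F K Fbar E l Pb)
  {Ω : Type w'} [Field Ω] [Algebra K Ω]
  (k : Type w') [Field k] [Algebra K k] [Algebra k Ω] [IsScalarTower K k Ω] (ι ι' : Fbar →ₐ[K] Ω)

/-- **The bound object `𝒟_v̲` and `φ^{Θell}_{•,v̲}` are independent of the embedding `F̄ ↪ K̄_v̲` up to a canonical
isomorphism over `𝒟^{⊚±}`**: for two `K`-embeddings `ι, ι'` (decomposition groups `G_v̲`, `G_v̲'`) there is an
isomorphism `𝒟_v̲ ≅ 𝒟_v̲'` in the ambient orbit category — right multiplication by some `t ∈ Π_{X̲→_K}` lying over the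
conjugating `τ ∈ G_K` — whose composite with `φ^{Θell}_{•,v̲'}` is `φ^{Θell}_{•,v̲}` (`t ∈ Π_{X̲_K}` acts trivially on
`𝒟^{⊚±} = 𝓑(Π_{X̲_K})⁰`). [claim: Mochizuki2012, status: disputed] -/
theorem exists_iso_locModelObj_of_embeddings :
    ∃ e : D.locModelObj (decompositionSubgroupGF F k ι) ≅ D.locModelObj (decompositionSubgroupGF F k ι'),
      e.hom ≫ D.phiEllAt (decompositionSubgroupGF F k ι') = D.phiEllAt (decompositionSubgroupGF F k ι) := by
  obtain ⟨τ, hτK, hG⟩ := exists_decompositionSubgroupGF_conj F k ι ι'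
  obtain ⟨t, ht, htτ⟩ := D.galoisSubgroupOf_le_map_PiXarrow hτK
  refine ⟨OrbitCat.isoOfConj t (fun x => D.mem_locSub_iff_of_conj hG ht htτ x), ?_⟩
  refine OrbitCat.hom_ext_fn (funext fun q => Quotient.inductionOn' q fun x => ?_)
  dsimp only [OrbitCat.isoOfConj]
  change OrbitCat.fn (OrbitCat.homOfElem t _ ≫ D.phiEllAt (decompositionSubgroupGF F k ι')) (QuotientGroup.mk x) =
    OrbitCat.fn (D.phiEllAt (decompositionSubgroupGF F k ι)) (QuotientGroup.mk x)
  rw [OrbitCat.fn_comp, Function.comp_apply, OrbitCat.fn_homOfElem, fn_phiEllAt, fn_phiEllAt]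
  refine QuotientGroup.eq.mpr ?_
  rw [mul_inv_rev, inv_mul_cancel_right]
  exact D.PiXund.inv_mem (D.PiXarrow_le_PiXund ht)

/-- Hence `𝒟_v̲'` is an isomorph of `𝒟_v̲` (the kit predicate `IsLocal v` / `IsLocIsomorph`) and conversely.
[claim: Mochizuki2012, status: disputed] -/
theorem isLocIsomorph_locModelObj_of_embeddings :
    D.IsLocIsomorph (decompositionSubgroupGF F k ι) (D.locModelObj (decompositionSubgroupGF F k ι')) := by
  obtain ⟨e, -⟩ := D.exists_iso_locModelObj_of_embeddings k ι ι'
  exact ⟨e.symm⟩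

end Embeddings

end InitialThetaData

end Literature.IUT.HodgeTheaters

end
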